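import Summits.ABC.IUTFork.Thm311RealInd1StripTwistLattice
import Mathlib.Algebra.BigOperators.Group.Finset.Basic
import HarnessLib

/-!
# Lattices stable under the transvection pairs of SEVERAL twist planes: simultaneous splitting (helper for the all-planes
# obstruction `f` odd, `e ≥ 3`)

PROOF-ONLY, Mathlib-only helper (abc-iut cell, Cor. 3.12 sub-crew, seat abc-iut-c312-1 gen 9; row «R10 IND1-STRIP-MOVER-JW»,
successor brick «ALL PLANES», kit `staging/c312/c312-1/g9/NEXT-ALL-PLANES.md`).  TAKES NO SIDE on [IUTchIII] Cor. 3.12.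

Setting of `Thm311RealInd1StripTwistLattice` with a FAMILY of twist planes `i : ι` (Jannsen–Wingberg: the planes
`(a_i, b_i)` of ONE basis, K. Kondo arXiv:2512.09231 §2 — the named fact `DehnTwistTransvectionsOnUnitsAll`): vectors
`ya i, yb i`, coordinate functionals `ca i, cb i` with the Kronecker dualities `ca i (ya j) = [i = j]`, `cb i (yb j) = [i = j]`,
`ca i (yb j) = 0 = cb i (ya j)`, and an additive subgroup `Λ` stable under BOTH elementary transvections of EVERY plane.
Proved: per-plane components lie in `Λ` (`smul_ya_mem_of_all`, `smul_yb_mem_of_all`, from the one-plane lemmas), the plane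
coefficients agree (`smul_yb_mem_iff_of_all`), and the **plane-stripped remainder** `v − Σ_i (ca i v • ya i + cb i v • yb i)`
lies in `Λ` with ALL plane coordinates zero (`strip_mem`, `ca_strip`, `cb_strip`) — i.e.
`Λ = ⊕_i A_i·(ya i ⊕ yb i) ⊕ (Λ ∩ ⋂_i ker ca i ∩ ker cb i)`, the decomposition whose index bookkeeping
(`[Λ_m : Λ_{m+1}] = p^f = p^{2 n_m + γ_m}`) yields the parity obstruction.  Classical linear algebra.
[cite: NeukirchSchmidtWingberg2008, Thm 7.5.14]
-/

namespace Summit.ABC.IUTFork.Thm311.TwistLattice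

open Finset

variable {R : Type*} [CommRing R] {V : Type*} [AddCommGroup V] [Module R V]
variable {ι : Type*} [Fintype ι] [DecidableEq ι]
variable {ca cb : ι → (V →ₗ[R] R)} {ya yb : ι → V} {Λ : AddSubgroup V}
variable (hΛ : ∀ i, (∀ v ∈ Λ, v + cb i v • ya i ∈ Λ) ∧ (∀ v ∈ Λ, v - ca i v • yb i ∈ Λ))
variable (haa : ∀ i j, ca i (ya j) = if i = j then 1 else 0) (hbb : ∀ i j, cb i (yb j) = if i = j then 1 else 0)
variable (hab : ∀ i j, ca i (yb j) = 0) (hba : ∀ i j, cb i (ya j) = 0)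

omit [Fintype ι] in
include hΛ hbb in
/-- The `ca i`-component of `v ∈ Λ`, placed on `ya i`, lies in `Λ` (one-plane lemma at plane `i`). [folklore] -/
theorem smul_ya_mem_of_all (i : ι) {v : V} (hv : v ∈ Λ) : ca i v • ya i ∈ Λ :=
  smul_ya_mem (hΛ i) (by rw [hbb, if_pos rfl]) hv

omit [Fintype ι] in
include hΛ haa in
/-- The `cb i`-component of `v ∈ Λ`, placed on `yb i`, lies in `Λ`. [folklore] -/
theorem smul_yb_mem_of_all (i : ι) {v : V} (hv : v ∈ Λ) : cb i v • yb i ∈ Λ :=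
  smul_yb_mem (hΛ i) (by rw [haa, if_pos rfl]) hv

omit [Fintype ι] in
include hΛ haa hbb in
/-- One coefficient group per plane: `r • yb i ∈ Λ ↔ r • ya i ∈ Λ`. [folklore] -/
theorem smul_yb_mem_iff_of_all (i : ι) (r : R) : r • yb i ∈ Λ ↔ r • ya i ∈ Λ :=
  smul_yb_mem_iff (hΛ i) (by rw [haa, if_pos rfl]) (by rw [hbb, if_pos rfl]) r

include hΛ haa hbb in
/-- **The plane-stripped remainder lies in `Λ`**: `v − Σ_i (ca i v • ya i + cb i v • yb i) ∈ Λ` for `v ∈ Λ`. [folklore] -/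
theorem strip_mem {v : V} (hv : v ∈ Λ) : v - ∑ i, (ca i v • ya i + cb i v • yb i) ∈ Λ := by
  refine Λ.sub_mem hv (Λ.sum_mem fun i _ => ?_)
  exact Λ.add_mem (smul_ya_mem_of_all hΛ hbb i hv) (smul_yb_mem_of_all hΛ haa i hv)

include haa hab in
/-- The remainder has all `ca`-coordinates zero. [folklore] -/
theorem ca_strip (v : V) (j : ι) : ca j (v - ∑ i, (ca i v • ya i + cb i v • yb i)) = 0 := by
  simp only [map_sub, map_sum, map_add, map_smul, smul_eq_mul, haa, hab, mul_zero, add_zero]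
  rw [Finset.sum_eq_single j]
  · rw [if_pos rfl, mul_one, sub_self]
  · intro i _ hij
    rw [if_neg (Ne.symm hij), mul_zero]
  · intro hj
    exact absurd (Finset.mem_univ j) hj

include hbb hba in
/-- The remainder has all `cb`-coordinates zero. [folklore] -/
theorem cb_strip (v : V) (j : ι) : cb j (v - ∑ i, (ca i v • ya i + cb i v • yb i)) = 0 := by
  simp only [map_sub, map_sum, map_add, map_smul, smul_eq_mul, hbb, hba, mul_zero, zero_add]
  rw [Finset.sum_eq_single j]
  · rw [if_pos rfl, mul_one, sub_self]
  · intro i _ hij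
    rw [if_neg (Ne.symm hij), mul_zero]
  · intro hj
    exact absurd (Finset.mem_univ j) hj

include hΛ haa hbb hab hba in
/-- **Simultaneous splitting**: every `v ∈ Λ` is the sum of its `2·|ι|` plane components (each in `Λ`) and a remainder in
`Λ` with all plane coordinates zero — `Λ = ⊕_i A_i·(ya i ⊕ yb i) ⊕ (Λ ∩ ⋂_i ker ca i ∩ ker cb i)`. [folklore] -/
theorem exists_decomposition {v : V} (hv : v ∈ Λ) :
    ∃ w ∈ Λ, (∀ j, ca j w = 0 ∧ cb j w = 0) ∧ v = ∑ i, (ca i v • ya i + cb i v • yb i) + w :=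
  ⟨v - ∑ i, (ca i v • ya i + cb i v • yb i), strip_mem hΛ haa hbb hv,
    fun j => ⟨ca_strip haa hab v j, cb_strip hbb hba v j⟩, by rw [add_sub_cancel]⟩

end Summit.ABC.IUTFork.Thm311.TwistLattice
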